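import Mathlib
import Literature.NumberTheory.Transcendental.ZagierDilogarithmConjecture
import Literature.NumberTheory.Transcendental.BlochWignerDilogarithm
import Summits.KontsevichZagierPeriods.KontsevichZagierPeriods.Theorems.ZagierDilogarithmConjecture.Negative.DehnInvariant
import Summits.KontsevichZagierPeriods.KontsevichZagierPeriods.Theorems.HyperbolicBlochZagierDilogarithmConjectureClausenTransfer
import HarnessLib

/-!
# `ZagierDilogarithmConjecture` (stmt-KontsevichZagierPeriods-10550) — Dehn rigidity of vanishing
# Clausen sums: the provable periphery of the open stub `stub_dehnRigidity`

Line `kummer-clausen-linearisation`, crux `ZagierDilogarithmConjecture` (route `HyperbolicBloch`),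
generation 2. The registered stub `stub_dehnRigidity` reads: for algebraic `u₁, …, u_k` of modulus
one in the upper half plane and integers `mᵢ` with `Σ mᵢ D(uᵢ) = 0` (`D` the Bloch–Wigner
dilogarithm), every Dehn-type invariant `dehn φ ψ` of `Negative/DehnInvariant.lean`
(`[z] ↦ s(z) − s(z̄)`, `s(z) = φ(z)ψ(1 − z) − ψ(z)φ(1 − z)` for additive characters
`φ, ψ : ℂˣ → ℚ`) vanishes on `Σ mᵢ[uᵢ]`: "volume zero ⇒ Dehn invariant zero" for `ℚ̄`-ideal
tetrahedra with unimodular cross-ratio. In general this is OPEN (for `u₁ = (3+4i)/5`, `u₂ = i` it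
is the irrationality of `D((3+4i)/5)/G`, `G` Catalan's constant). What is provable:

* `dehnRigidity_of_relationsConjecture`, `dehnRigidity_of_crux` — the stub is IMPLIED BY THE CRUX:
  Zagier's conjecture puts `Σ mᵢ[uᵢ]` in `⟨dilogRelators⟩` (`clausenForm_of_relationsConjecture`)
  and every `dehn φ ψ` kills that subgroup (`dehn_eq_zero_of_mem_closure`, Dupont–Sah). Hence a
  refutation of the stub would refute Zagier's conjecture.
* `dehn_sum_eq_zero_of_pow_eq_one`, `dehnRigidity_cyclotomic` — the CYCLOTOMIC sector holds
  unconditionally and without any volume hypothesis: `ℚ`-valued characters kill roots of unity, so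
  `dehn φ ψ [ζ] = 0` (Milnor's sector of the conjecture carries no Dehn obstruction).
* `sym_conj_of_norm_eq_one`, `asym_eq_two_mul_sym_of_norm_eq_one`,
  `dehn_sum_eq_two_mul_of_norm_eq_one` (= the registered by-product `stub_dehnRigidityCircleForm`),
  `dehnRigidity_iff_blochCondition_of_norm_eq_one` — the
  CIRCLE FORM: for `‖z‖ = 1` one has `z̄ = z⁻¹`, whence `s(z̄) = −s(z)` and the anti-symmetrised
  symbol is twice the plain one; the stub is therefore equivalent to the plain Bloch condition
  `Σ mᵢ · uᵢ ∧ (1 − uᵢ) = 0` in `Λ²(ℂˣ) ⊗ ℚ`, tested against all pairs of characters.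
* `blochWignerDilog_pos`, `dehnRigidity_oneSigned`, `dehnRigidity_one` — the one-signed and the
  one-point cases of the stub hold, by positivity of `D` on the upper half plane
  (`vol T(z) = D(z) > 0`).
-/

noncomputable section

open scoped BigOperators ComplexConjugate
open Literature.NumberTheory.Transcendental

namespace Summit.KontsevichZagierPeriods.HyperbolicBloch.ZagierDilogarithm

open Summit.KontsevichZagierPeriods.KontsevichZagierPeriods.Theses.HyperbolicBloch
  (ZagierDilogarithmConjecture)
open Summit.KontsevichZagierPeriods.HyperbolicBloch.ZagierDilogarithmConjectureNegative
  (ext sym asym dehn dehn_of dehn_eq_zero_of_mem_closure ext_eq_zero_of_pow_eq_one ext_mul ext_inv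
    ext_neg ext_one ext_neg_one ext_div ext_of_ne crux_iff)

/-! ## §1 The stub is implied by the crux -/

/-- **`crux ⇒ stub_dehnRigidity`.** Zagier's conjecture (Literature form
`ZagierDilogarithmRelationsConjecture`) implies Dehn rigidity of vanishing Clausen sums: the
conjecture puts `Σ mᵢ[uᵢ]` in the relator subgroup (`clausenForm_of_relationsConjecture`), on which
every Dehn-type invariant `dehn φ ψ` vanishes (`dehn_eq_zero_of_mem_closure`).
[cite: DupontSah1982, §4] -/
theorem dehnRigidity_of_relationsConjecture (h : ZagierDilogarithmRelationsConjecture) :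
    ∀ (k : ℕ) (u : Fin k → ℂ) (m : Fin k → ℤ), (∀ i, IsAlgebraic ℚ (u i)) →
      (∀ i, 0 < (u i).im) → (∀ i, ‖u i‖ = 1) →
      ∑ i, (m i : ℝ) * blochWignerDilog (u i) = 0 →
        ∀ φ ψ : Additive ℂˣ →+ ℚ, dehn φ ψ (∑ i, m i • FreeAbelianGroup.of (u i)) = 0 :=
  fun k u m hu him hn hsum φ ψ =>
    dehn_eq_zero_of_mem_closure φ ψ (clausenForm_of_relationsConjecture h k u m hu him hn hsum)

/-- **`crux ⇒ stub_dehnRigidity`, route vocabulary.** The route decl `ZagierDilogarithmConjecture`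
(volume / `ℤ`-form, `crux_iff`) implies the registered stub `stub_dehnRigidity` verbatim.
[cite: DupontSah1982, §4] -/
theorem dehnRigidity_of_crux (h : ZagierDilogarithmConjecture) :
    ∀ (k : ℕ) (u : Fin k → ℂ) (m : Fin k → ℤ), (∀ i, IsAlgebraic ℚ (u i)) →
      (∀ i, 0 < (u i).im) → (∀ i, ‖u i‖ = 1) →
      ∑ i, (m i : ℝ) * blochWignerDilog (u i) = 0 →
        ∀ φ ψ : Additive ℂˣ →+ ℚ, dehn φ ψ (∑ i, m i • FreeAbelianGroup.of (u i)) = 0 :=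
  dehnRigidity_of_relationsConjecture (crux_iff.1 h)

/-! ## §2 The cyclotomic sector: no Dehn obstruction at roots of unity -/

/-- The symbol `s(ζ) = φ(ζ)ψ(1 − ζ) − ψ(ζ)φ(1 − ζ)` vanishes at a root of unity `ζ`
(`ℚ`-valued characters kill torsion, `ext_eq_zero_of_pow_eq_one`). [folklore] -/
theorem sym_eq_zero_of_pow_eq_one (φ ψ : Additive ℂˣ →+ ℚ) {ζ : ℂ} {N : ℕ} (hN : N ≠ 0)
    (hζ : ζ ^ N = 1) : sym φ ψ ζ = 0 := by
  simp only [sym, ext_eq_zero_of_pow_eq_one φ hN hζ, ext_eq_zero_of_pow_eq_one ψ hN hζ, zero_mul,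
    sub_self]

/-- The anti-symmetrised symbol `s(ζ) − s(ζ̄)` vanishes at a root of unity `ζ` (`ζ̄` is one too).
[folklore] -/
theorem asym_eq_zero_of_pow_eq_one (φ ψ : Additive ℂˣ →+ ℚ) {ζ : ℂ} {N : ℕ} (hN : N ≠ 0)
    (hζ : ζ ^ N = 1) : asym φ ψ ζ = 0 := by
  have hζ' : conj ζ ^ N = 1 := by rw [← map_pow, hζ, map_one]
  simp only [asym, sym_eq_zero_of_pow_eq_one φ ψ hN hζ, sym_eq_zero_of_pow_eq_one φ ψ hN hζ',
    sub_self]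

/-- **Cyclotomic sector (unconditional, no volume hypothesis).** If every `uᵢ` is a root of
unity, every Dehn-type invariant of `Σ mᵢ[uᵢ]` vanishes — whatever the integers `mᵢ`.
[folklore] -/
theorem dehn_sum_eq_zero_of_pow_eq_one {k : ℕ} (u : Fin k → ℂ) (m : Fin k → ℤ)
    (hu : ∀ i, ∃ N : ℕ, N ≠ 0 ∧ u i ^ N = 1) (φ ψ : Additive ℂˣ →+ ℚ) :
    dehn φ ψ (∑ i, m i • FreeAbelianGroup.of (u i)) = 0 := by
  rw [map_sum]
  refine Finset.sum_eq_zero fun i _ => ?_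
  obtain ⟨N, hN, hi⟩ := hu i
  rw [map_zsmul, dehn_of, asym_eq_zero_of_pow_eq_one φ ψ hN hi, smul_zero]

/-- **The registered stub `stub_dehnRigidity` holds on Milnor's sector**: when all points are
roots of unity its conclusion holds outright (the hypotheses "algebraic", "`Im > 0`", "modulus
one", "`Σ mᵢ D(uᵢ) = 0`" are not even needed). [folklore] -/
theorem dehnRigidity_cyclotomic :
    ∀ (k : ℕ) (u : Fin k → ℂ) (m : Fin k → ℤ), (∀ i, ∃ N : ℕ, N ≠ 0 ∧ u i ^ N = 1) →
      ∀ φ ψ : Additive ℂˣ →+ ℚ, dehn φ ψ (∑ i, m i • FreeAbelianGroup.of (u i)) = 0 :=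
  fun _ u m hu φ ψ => dehn_sum_eq_zero_of_pow_eq_one u m hu φ ψ

/-! ## §3 The circle form: on `‖z‖ = 1` the anti-symmetrised symbol is twice the plain one -/

/-- `s(1) = 0` (`φ(1) = 0` and `ext φ 0 = 0`). [folklore] -/
theorem sym_one (φ ψ : Additive ℂˣ →+ ℚ) : sym φ ψ 1 = 0 := by
  simp [sym, ext_one]

/-- **Conjugation is inversion on the circle, and the symbol is odd under it**: for `‖z‖ = 1`,
`s(z̄) = s(z⁻¹) = −s(z)`, since `φ(z⁻¹) = −φ(z)` and `1 − z⁻¹ = −(1 − z)·z⁻¹` gives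
`φ(1 − z⁻¹) = φ(1 − z) − φ(z)` (`φ(−1) = 0` over `ℚ`). [folklore] -/
theorem sym_conj_of_norm_eq_one {z : ℂ} (hz : ‖z‖ = 1) (φ ψ : Additive ℂˣ →+ ℚ) :
    sym φ ψ (conj z) = -sym φ ψ z := by
  have hz0 : z ≠ 0 := by
    rintro rfl
    simp at hz
  rcases eq_or_ne z 1 with rfl | hz1
  · rw [map_one, sym_one, neg_zero]
  have h1z : 1 - z ≠ 0 := sub_ne_zero.mpr (Ne.symm hz1)
  have hconj : conj z = z⁻¹ := (Complex.inv_eq_conj hz).symm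
  have h1 : (1 : ℂ) - z⁻¹ = -((1 - z) * z⁻¹) := by
    field_simp
    ring
  have e1 : ∀ u : Additive ℂˣ →+ ℚ, ext u (1 - z⁻¹) = ext u (1 - z) - ext u z := fun u => by
    rw [h1, ext_neg u (mul_ne_zero h1z (inv_ne_zero hz0)), ext_mul u h1z (inv_ne_zero hz0),
      ext_inv u hz0]
    ring
  simp only [sym]
  rw [hconj, e1 φ, e1 ψ, ext_inv φ hz0, ext_inv ψ hz0]
  ring

/-- **Circle form of the Dehn symbol.** For a unimodular point the anti-symmetrised symbol is
twice the plain symbol: `s(z) − s(z̄) = 2·s(z)` when `‖z‖ = 1`. [folklore] -/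
theorem asym_eq_two_mul_sym_of_norm_eq_one {z : ℂ} (hz : ‖z‖ = 1) (φ ψ : Additive ℂˣ →+ ℚ) :
    asym φ ψ z = 2 * sym φ ψ z := by
  rw [asym, sym_conj_of_norm_eq_one hz]
  ring

/-- **Dehn invariant of a unimodular chain.** If all `‖uᵢ‖ = 1` then
`dehn φ ψ (Σ mᵢ[uᵢ]) = 2 · Σ mᵢ · s(uᵢ)`. [folklore] -/
theorem dehn_sum_eq_two_mul_of_norm_eq_one {k : ℕ} (u : Fin k → ℂ) (m : Fin k → ℤ)
    (hn : ∀ i, ‖u i‖ = 1) (φ ψ : Additive ℂˣ →+ ℚ) :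
    dehn φ ψ (∑ i, m i • FreeAbelianGroup.of (u i)) = 2 * ∑ i, (m i : ℚ) * sym φ ψ (u i) := by
  rw [map_sum, Finset.mul_sum]
  refine Finset.sum_congr rfl fun i _ => ?_
  rw [map_zsmul, dehn_of, asym_eq_two_mul_sym_of_norm_eq_one (hn i), zsmul_eq_mul]
  ring

/-- **Pointwise circle form of the stub's conclusion.** If all `‖uᵢ‖ = 1` then, for each pair of
characters, `dehn φ ψ (Σ mᵢ[uᵢ]) = 0 ↔ Σ mᵢ · s(uᵢ) = 0`. [folklore] -/
theorem dehn_sum_eq_zero_iff_of_norm_eq_one {k : ℕ} (u : Fin k → ℂ) (m : Fin k → ℤ)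
    (hn : ∀ i, ‖u i‖ = 1) (φ ψ : Additive ℂˣ →+ ℚ) :
    dehn φ ψ (∑ i, m i • FreeAbelianGroup.of (u i)) = 0 ↔
      ∑ i, (m i : ℚ) * sym φ ψ (u i) = 0 := by
  rw [dehn_sum_eq_two_mul_of_norm_eq_one u m hn, mul_eq_zero, or_iff_right two_ne_zero]

/-- **`stub_dehnRigidity` ⇔ the plain Bloch condition.** On unimodular points the registered
stub (vanishing of all anti-symmetrised Dehn invariants `dehn φ ψ`) is equivalent to the vanishing
of the PLAIN Bloch symbol `Σ mᵢ · uᵢ ∧ (1 − uᵢ)` in `Λ²(ℂˣ) ⊗ ℚ` tested against every pair of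
additive characters `φ, ψ : ℂˣ → ℚ`: "volume zero ⇒ Bloch symbol zero `⊗ ℚ`". [folklore] -/
theorem dehnRigidity_iff_blochCondition_of_norm_eq_one :
    (∀ (k : ℕ) (u : Fin k → ℂ) (m : Fin k → ℤ), (∀ i, IsAlgebraic ℚ (u i)) →
      (∀ i, 0 < (u i).im) → (∀ i, ‖u i‖ = 1) →
      ∑ i, (m i : ℝ) * blochWignerDilog (u i) = 0 →
        ∀ φ ψ : Additive ℂˣ →+ ℚ, dehn φ ψ (∑ i, m i • FreeAbelianGroup.of (u i)) = 0) ↔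
    (∀ (k : ℕ) (u : Fin k → ℂ) (m : Fin k → ℤ), (∀ i, IsAlgebraic ℚ (u i)) →
      (∀ i, 0 < (u i).im) → (∀ i, ‖u i‖ = 1) →
      ∑ i, (m i : ℝ) * blochWignerDilog (u i) = 0 →
        ∀ φ ψ : Additive ℂˣ →+ ℚ, ∑ i, (m i : ℚ) * sym φ ψ (u i) = 0) :=
  forall₃_congr fun _ u m => forall₂_congr fun _ _ => forall_congr' fun hn =>
    forall_congr' fun _ => forall₂_congr fun φ ψ => dehn_sum_eq_zero_iff_of_norm_eq_one u m hn φ ψ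

/-- **Registered sub-goal `stub_dehnRigidityCircleForm` of the crux (line
`kummer-clausen-linearisation`, by-product of `stub_dehnRigidity`):** on unimodular chains every
Dehn-type invariant is twice the plain Bloch-symbol pairing,
`dehn φ ψ (Σ mᵢ[uᵢ]) = 2 · Σ mᵢ · s(uᵢ)` whenever all `‖uᵢ‖ = 1`. [folklore] -/
theorem stub_dehnRigidityCircleForm :
    ∀ (k : ℕ) (u : Fin k → ℂ) (m : Fin k → ℤ), (∀ i, ‖u i‖ = 1) →
      ∀ φ ψ : Additive ℂˣ →+ ℚ, dehn φ ψ (∑ i, m i • FreeAbelianGroup.of (u i)) =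
        2 * ∑ i, (m i : ℚ) * sym φ ψ (u i) :=
  fun _ u m hn φ ψ => dehn_sum_eq_two_mul_of_norm_eq_one u m hn φ ψ

/-! ## §4 The one-signed and one-point cases (positivity of `D` on the upper half plane) -/

/-- **Positivity of the Bloch–Wigner dilogarithm on the upper half plane**: `0 < D(z)` for
`Im z > 0`, as `D(z) = vol T(z)` (`idealTetrahedronVolume_eq_blochWignerDilog`) and the ideal
tetrahedron has positive volume (`idealTetrahedronVolume_pos`).
[cite: Milnor1982, Appendix, Lemma 2] -/
theorem blochWignerDilog_pos {z : ℂ} (hz : 0 < z.im) : 0 < blochWignerDilog z := by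
  rw [← BlochWignerVolume.idealTetrahedronVolume_eq_blochWignerDilog hz]
  exact idealTetrahedronVolume_pos hz

/-- A vanishing NON-NEGATIVE integer combination of Bloch–Wigner values at points of the upper
half plane has all coefficients zero. [cite: Milnor1982, Appendix, Lemma 2] -/
theorem eq_zero_of_sum_blochWignerDilog_eq_zero_of_nonneg {k : ℕ} (u : Fin k → ℂ)
    (m : Fin k → ℤ) (him : ∀ i, 0 < (u i).im) (hm : ∀ i, 0 ≤ m i)
    (hsum : ∑ i, (m i : ℝ) * blochWignerDilog (u i) = 0) : ∀ i, m i = 0 := by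
  have hterm : ∀ i ∈ Finset.univ, 0 ≤ (m i : ℝ) * blochWignerDilog (u i) := fun i _ =>
    mul_nonneg (by exact_mod_cast hm i) (blochWignerDilog_pos (him i)).le
  have hzero := (Finset.sum_eq_zero_iff_of_nonneg hterm).1 hsum
  intro i
  rcases mul_eq_zero.1 (hzero i (Finset.mem_univ i)) with h | h
  · exact_mod_cast h
  · exact absurd h (blochWignerDilog_pos (him i)).ne'

/-- **One-signed case of `stub_dehnRigidity`.** If the `mᵢ` are all `≥ 0` or all `≤ 0`, then
`Σ mᵢ D(uᵢ) = 0` with `Im uᵢ > 0` forces every `mᵢ = 0`, so every Dehn-type invariant of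
`Σ mᵢ[uᵢ]` vanishes (no algebraicity or unimodularity needed). [cite: Milnor1982, Appendix, Lemma 2] -/
theorem dehnRigidity_oneSigned {k : ℕ} (u : Fin k → ℂ) (m : Fin k → ℤ)
    (him : ∀ i, 0 < (u i).im) (hm : (∀ i, 0 ≤ m i) ∨ ∀ i, m i ≤ 0)
    (hsum : ∑ i, (m i : ℝ) * blochWignerDilog (u i) = 0) (φ ψ : Additive ℂˣ →+ ℚ) :
    dehn φ ψ (∑ i, m i • FreeAbelianGroup.of (u i)) = 0 := by
  have hm0 : ∀ i, m i = 0 := by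
    rcases hm with hm | hm
    · exact eq_zero_of_sum_blochWignerDilog_eq_zero_of_nonneg u m him hm hsum
    · have h := eq_zero_of_sum_blochWignerDilog_eq_zero_of_nonneg u (fun i => -m i) him
        (fun i => neg_nonneg.2 (hm i))
        (by simpa [neg_mul, Finset.sum_neg_distrib] using hsum)
      exact fun i => neg_eq_zero.1 (h i)
  rw [Finset.sum_eq_zero fun i _ => by rw [hm0 i, zero_smul], map_zero]

/-- **One-point case `k = 1` of `stub_dehnRigidity`.** A single term `m · D(u) = 0` with
`Im u > 0` has `m = 0` (`D(u) > 0`), so the Dehn invariants of `m[u]` vanish.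
[cite: Milnor1982, Appendix, Lemma 2] -/
theorem dehnRigidity_one (u : Fin 1 → ℂ) (m : Fin 1 → ℤ) (him : ∀ i, 0 < (u i).im)
    (hsum : ∑ i, (m i : ℝ) * blochWignerDilog (u i) = 0) (φ ψ : Additive ℂˣ →+ ℚ) :
    dehn φ ψ (∑ i, m i • FreeAbelianGroup.of (u i)) = 0 := by
  rcases le_total 0 (m 0) with h | h
  · exact dehnRigidity_oneSigned u m him (Or.inl (Fin.forall_fin_one.2 h)) hsum φ ψ
  · exact dehnRigidity_oneSigned u m him (Or.inr (Fin.forall_fin_one.2 h)) hsum φ ψ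

end Summit.KontsevichZagierPeriods.HyperbolicBloch.ZagierDilogarithm

end
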